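import Mathlib.RingTheory.ZMod.UnitsCyclic
import Literature.NumberTheory.GaloisRepresentations.LocalKroneckerWeberInertiaProofs
import Literature.NumberTheory.GaloisRepresentations.LocalOneUnitsProofs
import Literature.NumberTheory.GaloisRepresentations.DecompositionGroupOfCompletion
import Literature.NumberTheory.GaloisRepresentations.SorensenPatching
import Literature.NumberTheory.EllipticCurves.AnticyclotomicPrimeDecompositionAboveProofs
import HarnessLib

/-!
# The `ℤ_p²`-tower of an imaginary quadratic field is unramified over its anticyclotomic line
# above a split prime `p` (inertia above `p` in `ℤ_p`-extensions)

Topic `NumberTheory/EllipticCurves` (Iwasawa theory of `ℤ_p`-extensions); namespace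
`Literature.NumberTheory.EllipticCurves.ZpExtension`.  THEOREMS ONLY (no definition, no named fact,
no instance; D-0026).

## What is printed, and what is proved here

Let `K` be an imaginary quadratic field and `p` an odd prime which SPLITS in `K`, `p = v v̄`.  All
`ℤ_p`-extensions of `K` lie in the `ℤ_p²`-extension `K̃_∞` (Washington Thm. 13.4; tree
`zpRank_imaginaryQuadratic_holds`), among them the anticyclotomic one `K_∞⁻` (pro-dihedral over
`ℚ`; tree `ZpExtension.IsAnticyclotomic`, Brink 2007 §II Prop. 1).  The classical facts

* Greenberg, *Iwasawa theory for elliptic curves*, LNM 1716 (1999), §1 p. 53: "one can verify that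
  `F̃/F_∞` is unramified if `p` is a prime that splits completely in `F/ℚ`" (there for the
  cyclotomic line; the same verification for ANY `ℤ_p`-extension of `K` ramified above `p`);
* Greenberg, Invent. Math. 47 (1978), §4 p. 94: "Assume that `p` splits in `L` and let `𝔭` be one
  of its prime factors. … `L` has a unique `ℤ_p`-extension in which only the prime `𝔭` is
  ramified"; de Shalit 1987 II.1.9, II.4.17 ("the unique `ℤ_p` extension of `K` unramified
  outside `𝔭`");
* Brink, Math. Comp. 76 (2007), proof of Cor. 1 (p. 2136): "The prime `l` is (infinitely) ramified
  in `K^anti`, since otherwise `K^anti` would be an infinite unramified extension of `K`,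
  contradicting the finiteness of the class number";

rest on one local statement — **the inertia group of a prime above `p` has `ℤ_p`-rank ONE in
`Gal(K̃_∞/K) ≅ ℤ_p²`** (`K_v = ℚ_p`, whose inertia group in `Gal(ℚ_p^{ab}/ℚ_p)` is `ℤ_pˣ` by the
local Kronecker–Weber theorem, Serre, *Local Fields* XIV §7 Thm. 2) — and one global statement —
**`K_∞⁻/K` is ramified above `p`** (class number finite).  Together: `I_𝔓 ∩ Gal(K̄/K_∞⁻)` acts
trivially on `K̃_∞`, i.e. **`K̃_∞/K_∞⁻` is unramified above `p`** — the input of the Galois control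
step along `K̃_∞/K_∞⁻` in the two-variable descent of Rubin's main conjecture (cell bsd-eis, crux 2
`GoodLatticeBDPValue`, step (R3′); re-derived by hand in the cell's AUDIT-L13 row S5 (d)).  This
file PROVES it in the tree's choice-free vocabulary (`κ : ZpExtension K p` = a continuous surjection
`Γ_K ↠ ℤ_p`; inertia groups = Mathlib's `Ideal.inertia` of primes `𝔓` of `\bar ℤ_K`):

* §1 `padicCharacters_toAdd_mul_comm_of_mem_absInertia` — **two continuous `ℤ_p`-valued characters
  of `Γ_{ℚ_p}` are proportional on inertia** (`Λ₁(σ)Λ₂(τ) = Λ₂(σ)Λ₁(τ)` for `σ, τ ∈ I_{ℚ_p}`,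
  additive notation): level by level from the tree's inertia form of local Kronecker–Weber
  (`adicCompletion_rat_exists_eq_comp_cyclotomicCharacter_of_mem_absInertia`: a character with open
  kernel is `g(χ_p mod p^m)` on inertia) and the cyclicity of `(ℤ/p^m)ˣ` for odd `p`
  (Mathlib `ZMod.isCyclic_units_of_prime_pow`);
* §2 `toAdd_mul_comm_of_mem_inertia_of_ncard_primesOver_eq` — **transport to `I_𝔓 ≤ Γ_K` at a
  completely split `p`**: the decomposition group of a prime of `\bar ℤ_ℚ` above a completely split
  `(p)` lies in `res(Γ_K)` (tree `decompositionSubgroup_le_range_of_ncard_primesOver_eq`), the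
  decomposition/inertia groups of the prime cut out by `ℚ̄ → \bar ℚ_p` are `res(Γ_{ℚ_p})`,
  `res(I_{ℚ_p})` (tree `DecompositionGroupOfCompletion`), `Γ_ℚ` permutes the primes above `(p)`
  transitively, and `res : Γ_K → Γ_ℚ` is a closed embedding; so every `τ ∈ I_𝔓` is `φ(x)` for a
  continuous homomorphism `φ : Γ_{ℚ_p} → Γ_K` and some `x ∈ I_{ℚ_p}`, and §1 applies to `κᵢ ∘ φ`;
* §3 `inertia_not_le_kerSubgroup_of_isAnticyclotomic` — **Brink's sentence in INERTIA form: the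
  anticyclotomic `ℤ_p`-extension is ramified at EVERY prime of `\bar ℤ_K` above `p`** (the tree's
  proof of `decomp_not_le_kerSubgroup_above_of_isAnticyclotomic_holds`, file
  `AnticyclotomicPrimeDecompositionAboveProofs`, run with the hypothesis on one inertia group instead
  of one decomposition group: pro-dihedral symmetry moves it to every prime above `p`, Washington
  Prop. 13.2 handles the primes away from `p`, and an everywhere unramified `ℤ_p`-extension would
  put `pⁿ ∣ h_K` for all `n` via the Hilbert class field);
* §4 **`inertia_inf_kerSubgroup_le_kerSubgroup_of_isAnticyclotomic`** — the assembly: for `K`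
  imaginary quadratic, `p` odd and split in `K`, `κ₁` anticyclotomic and `κ₂` ANY `ℤ_p`-extension of
  `K`, `I_𝔓 ⊓ ker κ₁ ≤ ker κ₂` for every prime `𝔓` of `\bar ℤ_K` above `p` (`ℤ_p` is a domain: pick
  `τ ∈ I_𝔓` with `κ₁ τ ≠ 0` by §3, then `κ₂(σ)·κ₁(τ) = κ₁(σ)·κ₂(τ) = 0` by §2); with the membership
  form `apply_eq_one_of_mem_inertia_of_isAnticyclotomic`.

Stated for `K : Type` (the universe of the tree's Hilbert class field theory used in §3 and of every
consumer).  Scope: `p` odd throughout (§1 uses the cyclicity of `(ℤ/p^m)ˣ`; for `p = 2` the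
statement of §1 is still true — `1 + 4ℤ₂` is pro-cyclic — but is not needed).  Nothing here
concerns an elliptic curve; BSD is not advanced by this file beyond supplying a class-field-theoretic
input of route `EisensteinPrimes`, crux 2, by a kernel theorem instead of a displayed hypothesis.

## References

* J.-P. Serre, *Local Fields*, GTM 67 (1979), Ch. XIV §7 Thm. 2 (local Kronecker–Weber), Ch. IV
  §4 Prop. 17; Ch. I §7 Prop. 22. [SerreLocalFields1979]
* R. Greenberg, *On the structure of certain Galois groups*, Invent. Math. 47 (1978) 85–99, §4
  p. 94. [Greenberg1978]
* R. Greenberg, *Iwasawa theory for elliptic curves*, LNM 1716 (1999), §1 p. 53. [GreenbergLNM1716]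
* E. de Shalit, *Iwasawa theory of elliptic curves with complex multiplication*, Persp. Math. 3
  (1987), II.1.9 Prop., II.4.17. [deShalit1987]
* D. Brink, *Prime decomposition in the anti-cyclotomic extension*, Math. Comp. 76 (2007)
  2127–2138, Cor. 1 (p. 2136) and its proof; §II Prop. 1 (p. 2130). [Brink2007]
* L. C. Washington, *Introduction to Cyclotomic Fields*, 2nd ed., GTM 83, §13.1 Prop. 13.2,
  Thm. 13.4. [Washington1997]
* J. Neukirch, *Algebraic Number Theory* (1999), Ch. I §9 (9.1), (9.3)–(9.6); Ch. II §9 (9.6).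
  [NeukirchANT1999]
* Cell records (bsd-eis): HOME/LIT-DOSSIER.md §58; HOME/ky-g7/AUDIT-L13-DRUNG.md row S5 (d);
  STATUS 2026-08-26T15:37:20Z (k5-c2 g4, (R3′) files (A)–(C)).
-/

noncomputable section

open scoped NumberField Pointwise
open Field NumberField IsDedekindDomain ValuativeRel

namespace Literature.NumberTheory.EllipticCurves.ZpExtension

open Literature.NumberTheory.GaloisRepresentations Literature.NumberTheory.NumberFields

/-! ### §1. Two `ℤ_p`-valued characters of `Γ_{ℚ_p}` are proportional on inertia -/

section Local

variable (p : ℕ) [Fact p.Prime] (u : HeightOneSpectrum (𝓞 ℚ))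

/-- **Two continuous `ℤ_p`-valued characters of `Γ_{ℚ_p}` are proportional on the inertia group**
(additively: `Λ₁(σ)·Λ₂(τ) = Λ₂(σ)·Λ₁(τ)` in `ℤ_p` for `σ, τ ∈ I_{ℚ_p}`), `p` odd, for the completion
`ℚ_u` of `ℚ` at the place `u` above `p`.  Proof: modulo `pⁿ` the pair `(Λ₁, Λ₂)` is a homomorphism
to the finite commutative group `(ℤ/pⁿ)²` with open kernel, so by the inertia form of the local
Kronecker–Weber theorem (Serre, *Local Fields* XIV §7 Thm. 2; tree
`adicCompletion_rat_exists_eq_comp_cyclotomicCharacter_of_mem_absInertia`) it is `g(χ_p mod p^m)` on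
`I_{ℚ_u}` for some `m ≥ 1` and a homomorphism `g` on `(ℤ/p^m)ˣ` — a CYCLIC group for odd `p`
(Mathlib `ZMod.isCyclic_units_of_prime_pow`), so the values on inertia are the multiples of the
single vector `g(ζ)`, whose `2 × 2` minors vanish; this holds modulo every `pⁿ`.  (Equivalently:
the inertia group of `Gal(ℚ_p^{ab}/ℚ_p)` is `ℤ_pˣ`, of `ℤ_p`-rank one.)
[cite: SerreLocalFields1979, Ch. XIV §7 Thm. 2] [cite: Washington1997, Thm. 14.2] -/
theorem padicCharacters_toAdd_mul_comm_of_mem_absInertia (hp2 : p ≠ 2)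
    (hu : (Rat.HeightOneSpectrum.primesEquiv u : ℕ) = p)
    (Λ₁ Λ₂ : absoluteGaloisGroup (u.adicCompletion ℚ) →* Multiplicative ℤ_[p])
    (h₁ : Continuous Λ₁) (h₂ : Continuous Λ₂)
    {σ τ : absoluteGaloisGroup (u.adicCompletion ℚ)}
    (hσ : σ ∈ absInertia (u.adicCompletion ℚ)) (hτ : τ ∈ absInertia (u.adicCompletion ℚ)) :
    (Λ₁ σ).toAdd * (Λ₂ τ).toAdd = (Λ₂ σ).toAdd * (Λ₁ τ).toAdd := by
  have hp : p.Prime := Fact.out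
  rw [← sub_eq_zero]
  refine PadicInt.ext_of_toZModPow.mp fun n => ?_
  rw [map_zero]
  -- the level-`n` reduction of the pair
  set r : Multiplicative ℤ_[p] →* Multiplicative (ZMod (p ^ n)) :=
    (PadicInt.toZModPow n).toAddMonoidHom.toMultiplicative with hr_def
  set Λ : absoluteGaloisGroup (u.adicCompletion ℚ) →*
      Multiplicative (ZMod (p ^ n)) × Multiplicative (ZMod (p ^ n)) :=
    (r.comp Λ₁).prod (r.comp Λ₂) with hΛ_def
  have hΛ₁ : ∀ x, (Λ x).1.toAdd = PadicInt.toZModPow n (Λ₁ x).toAdd := fun x => rfl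
  have hΛ₂ : ∀ x, (Λ x).2.toAdd = PadicInt.toZModPow n (Λ₂ x).toAdd := fun x => rfl
  -- its kernel is open
  have hU : IsOpen {z : ℤ_[p] | PadicInt.toZModPow n z = 0} :=
    OneUnits.isOpen_setOf_toZModPow_eq p n 0
  have hker : (Λ.ker : Set (absoluteGaloisGroup (u.adicCompletion ℚ))) =
      (fun x => (Λ₁ x).toAdd) ⁻¹' {z : ℤ_[p] | PadicInt.toZModPow n z = 0} ∩
        (fun x => (Λ₂ x).toAdd) ⁻¹' {z : ℤ_[p] | PadicInt.toZModPow n z = 0} := by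
    ext x
    simp only [SetLike.mem_coe, MonoidHom.mem_ker, Set.mem_inter_iff, Set.mem_preimage,
      Set.mem_setOf_eq, Prod.ext_iff, Prod.fst_one, Prod.snd_one, ← hΛ₁, ← hΛ₂]
    constructor
    · rintro ⟨h1, h2⟩
      exact ⟨by rw [h1]; rfl, by rw [h2]; rfl⟩
    · rintro ⟨h1, h2⟩
      exact ⟨Multiplicative.toAdd.injective (by rw [h1]; rfl),
        Multiplicative.toAdd.injective (by rw [h2]; rfl)⟩
  have hopen : IsOpen (Λ.ker : Set (absoluteGaloisGroup (u.adicCompletion ℚ))) := by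
    rw [hker]
    exact (hU.preimage (continuous_toAdd.comp h₁)).inter (hU.preimage (continuous_toAdd.comp h₂))
  have hcomm : ∀ a b, Λ a * Λ b = Λ b * Λ a := fun a b => mul_comm _ _
  -- local Kronecker–Weber on inertia
  obtain ⟨m, -, g, hg⟩ :=
    adicCompletion_rat_exists_eq_comp_cyclotomicCharacter_of_mem_absInertia p u hu Λ hopen hcomm
  -- `(ℤ/p^m)ˣ` is cyclic for odd `p`
  haveI : IsCyclic (ZMod (p ^ m))ˣ := ZMod.isCyclic_units_of_prime_pow p hp hp2 m
  obtain ⟨ζ, hζ⟩ := IsCyclic.exists_generator (α := (ZMod (p ^ m))ˣ)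
  obtain ⟨s, hs⟩ := Subgroup.mem_zpowers_iff.mp (hζ (Units.map (PadicInt.toZModPow m).toMonoidHom
    (GaloisRep.cyclotomicCharacter (u.adicCompletion ℚ) p σ)))
  obtain ⟨t, ht⟩ := Subgroup.mem_zpowers_iff.mp (hζ (Units.map (PadicInt.toZModPow m).toMonoidHom
    (GaloisRep.cyclotomicCharacter (u.adicCompletion ℚ) p τ)))
  have hΛσ : Λ σ = g ζ ^ s := by rw [hg σ hσ, ← hs, map_zpow]
  have hΛτ : Λ τ = g ζ ^ t := by rw [hg τ hτ, ← ht, map_zpow]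
  -- read off the four coordinates
  have e1 : PadicInt.toZModPow n (Λ₁ σ).toAdd = s • (g ζ).1.toAdd := by
    rw [← hΛ₁, hΛσ]; exact toAdd_zpow (g ζ).1 s
  have e2 : PadicInt.toZModPow n (Λ₂ σ).toAdd = s • (g ζ).2.toAdd := by
    rw [← hΛ₂, hΛσ]; exact toAdd_zpow (g ζ).2 s
  have e3 : PadicInt.toZModPow n (Λ₁ τ).toAdd = t • (g ζ).1.toAdd := by
    rw [← hΛ₁, hΛτ]; exact toAdd_zpow (g ζ).1 t
  have e4 : PadicInt.toZModPow n (Λ₂ τ).toAdd = t • (g ζ).2.toAdd := by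
    rw [← hΛ₂, hΛτ]; exact toAdd_zpow (g ζ).2 t
  rw [map_sub, map_mul, map_mul, e1, e2, e3, e4, zsmul_eq_mul, zsmul_eq_mul, zsmul_eq_mul,
    zsmul_eq_mul]
  ring

end Local

/-! ### §2. Transport to the inertia groups of `Γ_K` above a completely split `p` -/

section Global

variable {K : Type*} [Field K] [NumberField K] {p : ℕ} [Fact p.Prime]

/-- **At a prime `p` that splits completely in the Galois number field `K`, two continuous
`ℤ_p`-valued characters of `Γ_K` are proportional on every inertia group above `p`**
(`κ₁(σ)·κ₂(τ) = κ₂(σ)·κ₁(τ)` for `σ, τ ∈ I_𝔓`, `𝔓` a prime of `\bar ℤ_K` above a place `w ∣ p`;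
`p` odd).  Transport of §1: with `𝔔 = 𝔓 ∩ \bar ℤ_ℚ` (along the tree's `\bar ℤ_ℚ ≅ \bar ℤ_K`),
`𝔓₀` the prime of `\bar ℤ_ℚ` cut out by `ℚ̄ → \bar ℚ_p` and `ρ ∈ Γ_ℚ` with `ρ𝔓₀ = 𝔔` (Neukirch I
(9.1)), the homomorphism `x ↦ ρ·res(x)·ρ⁻¹ : Γ_{ℚ_p} → D_𝔔` lands in `res(Γ_K)` because `(p)` splits
completely (Neukirch I (9.3): `Z_𝔔 ⊆ Γ_K`; tree
`SorensenPatching.decompositionSubgroup_le_range_of_ncard_primesOver_eq`), giving a continuous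
`φ : Γ_{ℚ_p} → Γ_K` (`res : Γ_K → Γ_ℚ` is a closed embedding) with `φ(I_{ℚ_p}) ⊇ I_𝔓`
(`I_{𝔓₀} = res(I_{ℚ_p})`, Neukirch II (9.6), tree `inertia_adicCompletionPrime_eq_map_absInertia`);
apply §1 to `κᵢ ∘ φ`.
[cite: SerreLocalFields1979, Ch. XIV §7 Thm. 2] [cite: NeukirchANT1999, Ch. I §9 (9.1), (9.3); Ch. II §9 Prop. (9.6)] -/
theorem toAdd_mul_comm_of_mem_inertia_of_ncard_primesOver_eq [IsGalois ℚ K] (hp2 : p ≠ 2)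
    {u : HeightOneSpectrum (𝓞 ℚ)} (hu : (Rat.HeightOneSpectrum.primesEquiv u : ℕ) = p)
    (hsplit : (u.asIdeal.primesOver (𝓞 K)).ncard = Module.finrank ℚ K)
    {w : HeightOneSpectrum (𝓞 K)} (hwu : w.asIdeal.under (𝓞 ℚ) = u.asIdeal)
    {𝔓 : Ideal (absIntegers (𝓞 K) K)} (h𝔓 : 𝔓 ∈ w.primesAbove)
    (κ₁ κ₂ : absoluteGaloisGroup K →* Multiplicative ℤ_[p]) (h₁ : Continuous κ₁)
    (h₂ : Continuous κ₂) {σ τ : absoluteGaloisGroup K}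
    (hσ : σ ∈ 𝔓.inertia (absoluteGaloisGroup K)) (hτ : τ ∈ 𝔓.inertia (absoluteGaloisGroup K)) :
    (κ₁ σ).toAdd * (κ₂ τ).toAdd = (κ₂ σ).toAdd * (κ₁ τ).toAdd := by
  -- the contracted prime `𝔔` of `\bar ℤ_ℚ`, the prime `𝔓₀` of the completion, and `ρ𝔓₀ = 𝔔`
  have h𝔔 : 𝔓.comap (absIntegersMap ℚ K) ∈ u.primesAbove :=
    comap_absIntegersMap_mem_primesAbove hwu h𝔓
  have h𝔓₀ : adicCompletionPrime ℚ u ∈ u.primesAbove := adicCompletionPrime_mem_primesAbove ℚ u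
  obtain ⟨ρ, hρ⟩ := HeightOneSpectrum.exists_smul_eq_of_mem_primesAbove_holds h𝔓₀ h𝔔
  -- `D_𝔔 ≤ res(Γ_K)` since `(p)` splits completely in `K`
  have hD : (𝔓.comap (absIntegersMap ℚ K)).decompositionSubgroup (absoluteGaloisGroup ℚ) ≤
      (absGaloisRestrict ℚ K).toMonoidHom.range :=
    SorensenPatching.decompositionSubgroup_le_range_of_ncard_primesOver_eq hsplit h𝔔
  -- `ψ : x ↦ ρ res(x) ρ⁻¹` lands in `D_𝔔`
  set resu := (absGaloisRestrict ℚ (u.adicCompletion ℚ)).toMonoidHom with hresu_def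
  set ψ : absoluteGaloisGroup (u.adicCompletion ℚ) →* absoluteGaloisGroup ℚ :=
    (MulAut.conj ρ).toMonoidHom.comp resu with hψ_def
  have hψ : ∀ x, ψ x = ρ * resu x * ρ⁻¹ := fun x => rfl
  have hψD : ∀ x, ψ x ∈
      (𝔓.comap (absIntegersMap ℚ K)).decompositionSubgroup (absoluteGaloisGroup ℚ) := by
    intro x
    have hx : resu x ∈ (adicCompletionPrime ℚ u).decompositionSubgroup (absoluteGaloisGroup ℚ) := by
      rw [decompositionSubgroup_adicCompletionPrime_eq_range]
      exact ⟨x, rfl⟩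
    rw [← hρ, hψ, Ideal.decompositionSubgroup_smul]
    exact Subgroup.smul_mem_pointwise_smul (resu x) (MulAut.conj ρ) _ hx
  have hψr : ∀ x, ψ x ∈ (absGaloisRestrict ℚ K).toMonoidHom.range := fun x => hD (hψD x)
  -- `φ : Γ_{ℚ_p} → Γ_K` with `res ∘ φ = ψ`
  set e : absoluteGaloisGroup K ≃* (absGaloisRestrict ℚ K).toMonoidHom.range :=
    MonoidHom.ofInjective (absGaloisRestrict_injective ℚ K) with he_def
  set φ : absoluteGaloisGroup (u.adicCompletion ℚ) →* absoluteGaloisGroup K :=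
    e.symm.toMonoidHom.comp (ψ.codRestrict _ hψr) with hφ_def
  have hφ : ∀ x, absGaloisRestrict ℚ K (φ x) = ψ x := by
    intro x
    have h1 : e (φ x) = ψ.codRestrict _ hψr x := by
      simp only [hφ_def, MonoidHom.coe_comp, MulEquiv.coe_toMonoidHom, Function.comp_apply,
        MulEquiv.apply_symm_apply]
    have h2 := congrArg Subtype.val h1
    rwa [he_def, MonoidHom.ofInjective_apply] at h2
  have hφc : Continuous φ := by
    rw [(isClosedEmbedding_absGaloisRestrict ℚ K).continuous_iff]
    have hcomp : (absGaloisRestrict ℚ K : absoluteGaloisGroup K → absoluteGaloisGroup ℚ) ∘ φ =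
        fun x => ρ * resu x * ρ⁻¹ := funext fun x => hφ x
    rw [hcomp]
    exact ((continuous_const.mul (absGaloisRestrict ℚ (u.adicCompletion ℚ)).continuous).mul
      continuous_const)
  -- every element of `I_𝔓` lifts to `I_{ℚ_p}` along `φ`
  have lift : ∀ γ ∈ 𝔓.inertia (absoluteGaloisGroup K),
      ∃ x ∈ absInertia (u.adicCompletion ℚ), φ x = γ := by
    intro γ hγ
    have h1 : absGaloisRestrict ℚ K γ ∈
        (ρ • adicCompletionPrime ℚ u).inertia (absoluteGaloisGroup ℚ) := by
      rw [hρ]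
      exact absGaloisRestrict_mem_inertia_comap ℚ K hγ
    have h2 : ρ⁻¹ * absGaloisRestrict ℚ K γ * ρ ∈
        (adicCompletionPrime ℚ u).inertia (absoluteGaloisGroup ℚ) :=
      (HeightOneSpectrum.mem_inertia_smul_absIntegers_iff ρ _ _).mp h1
    rw [inertia_adicCompletionPrime_eq_map_absInertia] at h2
    obtain ⟨x, hx, hxe⟩ := Subgroup.mem_map.mp h2
    refine ⟨x, hx, absGaloisRestrict_injective ℚ K ?_⟩
    rw [hφ, hψ]
    change ρ * absGaloisRestrict ℚ (u.adicCompletion ℚ) x * ρ⁻¹ = _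
    rw [show (absGaloisRestrict ℚ (u.adicCompletion ℚ)) x = ρ⁻¹ * absGaloisRestrict ℚ K γ * ρ
      from hxe]
    group
  obtain ⟨x, hx, rfl⟩ := lift σ hσ
  obtain ⟨y, hy, rfl⟩ := lift τ hτ
  exact padicCharacters_toAdd_mul_comm_of_mem_absInertia p u hp2 hu (κ₁.comp φ) (κ₂.comp φ)
    (h₁.comp hφc) (h₂.comp hφc) hx hy

end Global

/-! ### §3. Brink 2007, Cor. 1 in inertia form: `K_∞⁻` is ramified at every prime above `p` -/

section RatPlaces

/-- The finite places of `ℚ` containing a given rational prime coincide (`𝓞 ℚ ≅ ℤ`, Mathlib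
`Rat.HeightOneSpectrum.primesEquiv`). [folklore] -/
private theorem rat_heightOneSpectrum_eq_of_natCast_mem {u u' : HeightOneSpectrum (𝓞 ℚ)} {p : ℕ}
    (hp : p.Prime) (hu : (p : 𝓞 ℚ) ∈ u.asIdeal) (hu' : (p : 𝓞 ℚ) ∈ u'.asIdeal) : u = u' := by
  have key : ∀ u : HeightOneSpectrum (𝓞 ℚ), (p : 𝓞 ℚ) ∈ u.asIdeal →
      Rat.HeightOneSpectrum.natGenerator u = p := fun u h ↦ by
    have h1 : Rat.HeightOneSpectrum.natGenerator u ∣ p := by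
      rw [Rat.HeightOneSpectrum.natGenerator_dvd_iff]
      have h2 := Ideal.mem_map_of_mem (Rat.IsIntegralClosure.intEquiv (𝓞 ℚ)) h
      rwa [map_natCast] at h2
    exact (Nat.prime_dvd_prime_iff_eq (Rat.HeightOneSpectrum.prime_natGenerator u) hp).mp h1
  apply (Rat.HeightOneSpectrum.primesEquiv (R := 𝓞 ℚ)).injective
  exact Subtype.ext ((key u hu).trans (key u' hu').symm)

/-- `primesEquiv u = p` for a place `u` of `ℚ` containing the rational prime `p`. [folklore] -/
private theorem primesEquiv_eq_of_natCast_mem {u : HeightOneSpectrum (𝓞 ℚ)} {p : ℕ}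
    (hp : p.Prime) (hu : (p : 𝓞 ℚ) ∈ u.asIdeal) :
    (Rat.HeightOneSpectrum.primesEquiv u : ℕ) = p := by
  have h1 : Rat.HeightOneSpectrum.natGenerator u ∣ p := by
    rw [Rat.HeightOneSpectrum.natGenerator_dvd_iff]
    have h2 := Ideal.mem_map_of_mem (Rat.IsIntegralClosure.intEquiv (𝓞 ℚ)) hu
    rwa [map_natCast] at h2
  exact (Nat.prime_dvd_prime_iff_eq (Rat.HeightOneSpectrum.prime_natGenerator u) hp).mp h1

/-- A place of a number field containing the rational prime `p` lies above the place `(p)` of `ℚ`: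
`(p : 𝓞 ℚ) ∈ 𝔭_w ∩ 𝓞 ℚ`. [folklore] -/
private theorem natCast_mem_under_rat {K : Type*} [Field K] [NumberField K]
    {w : HeightOneSpectrum (𝓞 K)} {p : ℕ} (hpw : ((p : ℕ) : 𝓞 K) ∈ w.asIdeal) :
    (p : 𝓞 ℚ) ∈ (w.under (𝓞 ℚ)).asIdeal := by
  rw [HeightOneSpectrum.under_asIdeal, Ideal.under_def, Ideal.mem_comap, map_natCast]
  exact hpw

/-- Two places of a number field containing the same rational prime lie over the same place of `ℚ`.
[folklore] -/
private theorem under_asIdeal_eq_of_natCast_mem {K : Type*} [Field K] [NumberField K] {p : ℕ}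
    (hp : p.Prime) {v w : HeightOneSpectrum (𝓞 K)} (hpv : ((p : ℕ) : 𝓞 K) ∈ v.asIdeal)
    (hpw : ((p : ℕ) : 𝓞 K) ∈ w.asIdeal) :
    v.asIdeal.under (𝓞 ℚ) = (w.under (𝓞 ℚ)).asIdeal := by
  rw [← rat_heightOneSpectrum_eq_of_natCast_mem hp (natCast_mem_under_rat hpv)
    (natCast_mem_under_rat hpw)]
  exact (HeightOneSpectrum.under_asIdeal (𝓞 ℚ) v).symm

end RatPlaces

section Anticyclotomic

variable {K : Type*} [Field K] [NumberField K] {p : ℕ} [Fact p.Prime]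

/-- **Pro-dihedral symmetry (Brink 2007, proof of Cor. 1 / §II Prop. 1): if ONE inertia group above
`p` lies in `ker κ` for an anticyclotomic `κ`, then EVERY inertia group of `\bar ℤ_K` above ANY place
`w ∣ p` does.**  Here `[K : ℚ] = 2`, `κ : Γ_K ↠ ℤ_p` is anticyclotomic (`IsAnticyclotomic`: every
`ρ ∈ Γ_ℚ ∖ Γ_K` acts on it by `-1`), `𝔓₁ ∣ v ∣ p` with `I_{𝔓₁} ≤ ker κ`, and `𝔓 ∣ w ∣ p`.  This is
the tree's `inertia_le_kerSubgroup_of_natCast_mem_of_decomp_le`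
(`AnticyclotomicPrimeDecompositionAboveProofs`, step 2) with its hypothesis `D_v ≤ ker κ` weakened to
the inertia group of an arbitrary prime above `v` — its proof used nothing more: contract along
`ι : \bar ℤ_ℚ ≅ \bar ℤ_K`; `Γ_ℚ` is transitive on the primes above `(p)` (Neukirch I (9.1)), say
`ρ • ι⁻¹𝔓₁ = ι⁻¹𝔓`; for `τ ∈ I_𝔓`, `ρ⁻¹ (res τ) ρ = res σ` with `σ ∈ I_{𝔓₁} ≤ ker κ` (index two of
`res(Γ_K)` in `Γ_ℚ` when `ρ ∉ res(Γ_K)`), and `κ τ = κ σ = 1` or `κ τ = (κ σ)⁻¹ = 1` according as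
`ρ ∈ res(Γ_K)` or not. [cite: Brink2007, Cor. 1 (p. 2136) and §II Prop. 1 (p. 2130)]
[cite: NeukirchANT1999, Ch. I §9 Prop. (9.1)] -/
theorem inertia_le_kerSubgroup_of_natCast_mem_of_inertia_le (hK : Module.finrank ℚ K = 2)
    (κ : ZpExtension K p) (hκ : κ.IsAnticyclotomic)
    {v : HeightOneSpectrum (𝓞 K)} (hpv : ((p : ℕ) : 𝓞 K) ∈ v.asIdeal)
    {𝔓₁ : Ideal (absIntegers (𝓞 K) K)} (h𝔓₁ : 𝔓₁ ∈ v.primesAbove)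
    (hI₁ : 𝔓₁.inertia (absoluteGaloisGroup K) ≤ κ.kerSubgroup)
    {w : HeightOneSpectrum (𝓞 K)} (hpw : ((p : ℕ) : 𝓞 K) ∈ w.asIdeal)
    {𝔓 : Ideal (absIntegers (𝓞 K) K)} (h𝔓 : 𝔓 ∈ w.primesAbove) :
    𝔓.inertia (absoluteGaloisGroup K) ≤ κ.kerSubgroup := by
  have hp : p.Prime := Fact.out
  -- the place `(p)` of `ℚ` below `v` and `w`
  have hvu : v.asIdeal.under (𝓞 ℚ) = (v.under (𝓞 ℚ)).asIdeal :=
    (HeightOneSpectrum.under_asIdeal (𝓞 ℚ) v).symm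
  have hwu : w.asIdeal.under (𝓞 ℚ) = (v.under (𝓞 ℚ)).asIdeal :=
    under_asIdeal_eq_of_natCast_mem hp hpw hpv
  -- the contracted primes of `\bar ℤ_ℚ` and the transporting element `ρ ∈ Γ_ℚ`
  have h𝔔 : 𝔓.comap (absIntegersMap ℚ K) ∈ (v.under (𝓞 ℚ)).primesAbove :=
    comap_absIntegersMap_mem_primesAbove hwu h𝔓
  have h𝔔₁ : 𝔓₁.comap (absIntegersMap ℚ K) ∈ (v.under (𝓞 ℚ)).primesAbove :=
    comap_absIntegersMap_mem_primesAbove hvu h𝔓₁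
  obtain ⟨ρ, hρ⟩ := HeightOneSpectrum.exists_smul_eq_of_mem_primesAbove_holds h𝔔₁ h𝔔
  intro τ hτ
  -- `ρ⁻¹ (res τ) ρ ∈ I_{ι⁻¹ 𝔓₁}`
  have h1 : absGaloisRestrict ℚ K τ ∈
      (ρ • 𝔓₁.comap (absIntegersMap ℚ K)).inertia (absoluteGaloisGroup ℚ) := by
    rw [hρ]
    exact absGaloisRestrict_mem_inertia_comap ℚ K hτ
  have h2 : ρ⁻¹ * absGaloisRestrict ℚ K τ * ρ ∈
      (𝔓₁.comap (absIntegersMap ℚ K)).inertia (absoluteGaloisGroup ℚ) :=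
    (HeightOneSpectrum.mem_inertia_smul_absIntegers_iff ρ _ _).mp h1
  -- any `σ ∈ Γ_K` restricting to it lies in `I_{𝔓₁}`, hence in `ker κ`
  have key : ∀ σ : absoluteGaloisGroup K,
      absGaloisRestrict ℚ K σ = ρ⁻¹ * absGaloisRestrict ℚ K τ * ρ → κ σ = 1 := by
    intro σ hσ
    have h3 : σ ∈ 𝔓₁.inertia (absoluteGaloisGroup K) := by
      rw [← comap_inertia_comap_absIntegersMap ℚ K 𝔓₁, Subgroup.mem_comap]
      change absGaloisRestrict ℚ K σ ∈ _
      rw [hσ]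
      exact h2
    exact mem_kerSubgroup.mp (hI₁ h3)
  rw [mem_kerSubgroup]
  by_cases hρr : ρ ∈ Set.range (absGaloisRestrict ℚ K)
  · -- `ρ = res σ₀`: `σ = σ₀⁻¹ τ σ₀ ∈ I_{𝔓₁}` and `κ τ = κ σ`
    obtain ⟨σ₀, rfl⟩ := hρr
    have hσ : absGaloisRestrict ℚ K (σ₀⁻¹ * τ * σ₀) =
        (absGaloisRestrict ℚ K σ₀)⁻¹ * absGaloisRestrict ℚ K τ * absGaloisRestrict ℚ K σ₀ := by
      rw [map_mul, map_mul, map_inv]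
    have h4 := key _ hσ
    rwa [map_mul, map_mul, map_inv, mul_comm (κ σ₀)⁻¹ (κ τ), mul_assoc, inv_mul_cancel,
      mul_one] at h4
  · -- `ρ ∉ res(Γ_K)`: index two gives `σ`, anticyclotomicity gives `κ τ = (κ σ)⁻¹`
    have hρ' : absGaloisRestrict ℚ K τ * ρ ∉ Set.range (absGaloisRestrict ℚ K) := by
      rintro ⟨σ', hσ'⟩
      exact hρr ⟨τ⁻¹ * σ', by rw [map_mul, map_inv, hσ', ← mul_assoc, inv_mul_cancel, one_mul]⟩
    obtain ⟨σ, hσ⟩ := inv_mul_mem_range_absGaloisRestrict hK hρr hρ'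
    have hσ' : absGaloisRestrict ℚ K σ = ρ⁻¹ * absGaloisRestrict ℚ K τ * ρ := by
      rw [hσ, mul_assoc]
    have h4 := key σ hσ'
    have h5 : κ τ = (κ σ)⁻¹ := hκ σ τ ρ hρr (by rw [hσ']; group)
    rw [h5, h4, inv_one]

end Anticyclotomic

section ClassNumber

variable {K : Type} [Field K] [NumberField K] {p : ℕ} [Fact p.Prime]

/-- **Brink 2007, Cor. 1 in INERTIA form: the anticyclotomic `ℤ_p`-extension of an imaginary
quadratic field is ramified at EVERY prime of `\bar ℤ_K` above `p`** — for `p` odd, `K` imaginary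
quadratic, `κ` anticyclotomic, `v ∣ p` and ANY prime `𝔓` of `\bar ℤ_K` above `v`, the inertia group
`I_𝔓 ≤ Γ_K` is NOT contained in `ker κ = Gal(K̄/K_∞)`.  Printed (p. 2136): "The prime `l` is
(infinitely) ramified in `K^anti`, since otherwise `K^anti` would be an infinite unramified extension
of `K`, contradicting the finiteness of the class number."  Proof exactly as the tree's
`decomp_not_le_kerSubgroup_above_of_isAnticyclotomic_holds` (which concludes the weaker
`¬ D_v ≤ ker κ`): if `I_𝔓 ≤ ker κ` then every inertia group lies in `ker κ`
(`inertia_le_kerSubgroup_of_natCast_mem_of_inertia_le` above `p`, Washington Prop. 13.2 —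
`inertia_le_kerSubgroup_holds` — away from `p`), so every layer `K_n/K` is abelian of degree `pⁿ`,
unramified at all finite places (`isUnramifiedIn_layer_of_forall_inertia_le`) and at infinity
(`pⁿ` odd), hence `pⁿ ∣ h_K` (Hilbert class field, `hilbertClassField.finrank_dvd_classNumber_of_abelian`)
for every `n` — absurd.  `K : Type` (universe of the tree's Hilbert class field).
[cite: Brink2007, Cor. 1 (p. 2136) and its proof; §II Prop. 1 (p. 2130)]
[cite: Washington1997, §13.1 Prop. 13.2] -/
theorem inertia_not_le_kerSubgroup_of_isAnticyclotomic (hK : IsImaginaryQuadratic K) (hp2 : p ≠ 2)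
    (κ : ZpExtension K p) (hκ : κ.IsAnticyclotomic)
    {v : HeightOneSpectrum (𝓞 K)} (hpv : ((p : ℕ) : 𝓞 K) ∈ v.asIdeal)
    {𝔓 : Ideal (absIntegers (𝓞 K) K)} (h𝔓 : 𝔓 ∈ v.primesAbove) :
    ¬ 𝔓.inertia (absoluteGaloisGroup K) ≤ κ.kerSubgroup := by
  intro hle
  have hp : p.Prime := Fact.out
  have hI : ∀ (w : HeightOneSpectrum (𝓞 K)) (𝔓' : Ideal (absIntegers (𝓞 K) K)),
      𝔓' ∈ w.primesAbove → 𝔓'.inertia (absoluteGaloisGroup K) ≤ κ.kerSubgroup := by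
    intro w 𝔓' h𝔓'
    by_cases hpw : ((p : ℕ) : 𝓞 K) ∈ w.asIdeal
    · exact inertia_le_kerSubgroup_of_natCast_mem_of_inertia_le hK.1 κ hκ hpv h𝔓 hle hpw h𝔓'
    · exact inertia_le_kerSubgroup_holds K p κ hpw h𝔓'
  -- every layer has degree `pⁿ` dividing the class number
  have hdvd : ∀ n : ℕ, p ^ n ∣ Fintype.card (ClassGroup (𝓞 K)) := by
    intro n
    haveI : FiniteDimensional K (κ.layer n) := κ.finiteDimensional_layer_holds n
    haveI : IsGalois K (κ.layer n) := κ.isGalois_layer_holds n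
    haveI : IsAbelianGalois K (κ.layer n) := κ.isAbelianGalois_layer n
    haveI : NumberField (κ.layer n) := NumberField.of_module_finite K (κ.layer n)
    haveI : IsUnramifiedAtInfinitePlaces K (κ.layer n) :=
      IsUnramifiedAtInfinitePlaces_of_odd_finrank
        (by rw [κ.finrank_layer_holds n]; exact (hp.odd_of_ne_two hp2).pow)
    have h := hilbertClassField.finrank_dvd_classNumber_of_abelian K (κ.layer n)
      (fun w ↦ isUnramifiedIn_layer_of_forall_inertia_le κ hI n w)
    rwa [κ.finrank_layer_holds n] at h
  -- but `p ^ h_K > h_K`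
  have hpos : 0 < Fintype.card (ClassGroup (𝓞 K)) := Fintype.card_pos
  exact absurd (Nat.le_of_dvd hpos (hdvd _)) (not_le.mpr (Nat.lt_pow_self hp.one_lt))

/-- Membership form of `inertia_not_le_kerSubgroup_of_isAnticyclotomic`: **every inertia group above
`p` contains an element acting non-trivially on the anticyclotomic tower** (`κ τ ≠ 0` in `ℤ_p`).
[cite: Brink2007, Cor. 1 (p. 2136) and its proof] -/
theorem exists_mem_inertia_apply_ne_one_of_isAnticyclotomic (hK : IsImaginaryQuadratic K)
    (hp2 : p ≠ 2) (κ : ZpExtension K p) (hκ : κ.IsAnticyclotomic)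
    {v : HeightOneSpectrum (𝓞 K)} (hpv : ((p : ℕ) : 𝓞 K) ∈ v.asIdeal)
    {𝔓 : Ideal (absIntegers (𝓞 K) K)} (h𝔓 : 𝔓 ∈ v.primesAbove) :
    ∃ τ ∈ 𝔓.inertia (absoluteGaloisGroup K), κ τ ≠ 1 := by
  by_contra h
  exact inertia_not_le_kerSubgroup_of_isAnticyclotomic hK hp2 κ hκ hpv h𝔓
    fun τ hτ ↦ mem_kerSubgroup.mpr (by_contra fun hne ↦ h ⟨τ, hτ, hne⟩)

/-! ### §4. Assembly: `K̃_∞/K_∞⁻` is unramified above `p` -/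

/-- At a prime `p` with two distinct places `v ≠ v̄` above it in the quadratic field `K` — i.e. `p`
SPLITS in `K` — there are exactly `[K : ℚ] = 2` primes of `𝓞 K` above `(p)` (fundamental identity
`∑ eᵢfᵢ = [K : ℚ]`, Neukirch, *Algebraic Number Theory*, Ch. I §8 Prop. (8.2), in its Galois form
Ch. I §9: `r·e·f = n`; Mathlib `Ideal.ncard_primesOver_mul_ramificationIdxIn_mul_inertiaDegIn`).
[cite: NeukirchANT1999, Ch. I §8 Prop. (8.2)] -/
theorem ncard_primesOver_under_eq_finrank_of_ne (hK2 : Module.finrank ℚ K = 2)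
    {v vbar : HeightOneSpectrum (𝓞 K)} (hpv : ((p : ℕ) : 𝓞 K) ∈ v.asIdeal)
    (hpvbar : ((p : ℕ) : 𝓞 K) ∈ vbar.asIdeal) (hne : vbar ≠ v) :
    (((v.under (𝓞 ℚ)).asIdeal).primesOver (𝓞 K)).ncard = Module.finrank ℚ K := by
  have hp : p.Prime := Fact.out
  haveI : Algebra.IsQuadraticExtension ℚ K := ⟨hK2⟩
  haveI : IsGalois ℚ K := inferInstance
  haveI : IsGaloisGroup (K ≃ₐ[ℚ] K) (𝓞 ℚ) (𝓞 K) := IsGaloisGroup.of_isFractionRing _ _ _ ℚ K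
  set u := v.under (𝓞 ℚ) with hu_def
  haveI := u.isPrime
  -- `v`, `v̄` are two distinct primes over `u`
  have hvu : v.asIdeal ∈ u.asIdeal.primesOver (𝓞 K) :=
    ⟨v.isPrime, ⟨HeightOneSpectrum.under_asIdeal (𝓞 ℚ) v⟩⟩
  have hvbaru : vbar.asIdeal ∈ u.asIdeal.primesOver (𝓞 K) :=
    ⟨vbar.isPrime, ⟨(under_asIdeal_eq_of_natCast_mem hp hpvbar hpv).symm⟩⟩
  have hne' : vbar.asIdeal ≠ v.asIdeal := fun h ↦ hne (HeightOneSpectrum.ext h)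
  -- the fundamental identity `#primes · e · f = 2`
  have hid := Ideal.ncard_primesOver_mul_ramificationIdxIn_mul_inertiaDegIn u.asIdeal (𝓞 K)
    (K ≃ₐ[ℚ] K)
  rw [IsGalois.card_aut_eq_finrank, hK2] at hid
  rw [hK2]
  have hn0 : (u.asIdeal.primesOver (𝓞 K)).ncard ≠ 0 := fun h ↦ by
    rw [h, zero_mul] at hid
    exact two_ne_zero hid.symm
  have hfin : (u.asIdeal.primesOver (𝓞 K)).Finite := Set.finite_of_ncard_ne_zero hn0
  have h2 : 2 ≤ (u.asIdeal.primesOver (𝓞 K)).ncard := by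
    rw [← Set.ncard_pair hne']
    exact Set.ncard_le_ncard (Set.pair_subset hvbaru hvu) hfin
  have hle : (u.asIdeal.primesOver (𝓞 K)).ncard ≤ 2 := by
    rcases Nat.eq_zero_or_pos
        (u.asIdeal.ramificationIdxIn (𝓞 K) * u.asIdeal.inertiaDegIn (𝓞 K)) with h0 | hpos
    · rw [h0, mul_zero] at hid
      exact absurd hid (by norm_num)
    · calc (u.asIdeal.primesOver (𝓞 K)).ncard
          ≤ (u.asIdeal.primesOver (𝓞 K)).ncard *
              (u.asIdeal.ramificationIdxIn (𝓞 K) * u.asIdeal.inertiaDegIn (𝓞 K)) :=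
            Nat.le_mul_of_pos_right _ hpos
        _ = 2 := hid
  omega

/-- **`K̃_∞/K_∞⁻` is unramified above `p`: for `K` imaginary quadratic, `p` odd and SPLIT in `K`
(`v ≠ v̄` above `p`), an anticyclotomic `ℤ_p`-extension `κ₁` and ANY `ℤ_p`-extension `κ₂` of `K`, the
inertia group of every prime `𝔓` of `\bar ℤ_K` above `p` satisfies `I_𝔓 ⊓ ker κ₁ ≤ ker κ₂`** — an
element of inertia above `p` fixing `K_∞⁻` fixes every `ℤ_p`-extension of `K`, i.e. the `ℤ_p²`-tower
`K̃_∞` (Greenberg, LNM 1716 §1 p. 53, the sentence "`F̃/F_∞` is unramified if `p` … splits completely",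
for the anticyclotomic line; Greenberg 1978 §4 p. 94 / de Shalit II.4.17: the `ℤ_p`-extensions
unramified at `v̄` form the single line `N_v`).  Proof: by §3 there is `τ ∈ I_𝔓` with `κ₁ τ ≠ 0`; by
§2 (local Kronecker–Weber at the split prime) `κ₂(σ)·κ₁(τ) = κ₁(σ)·κ₂(τ) = 0` for `σ ∈ I_𝔓 ∩ ker κ₁`;
`ℤ_p` is a domain.  The CFT input of the Galois control step along `K̃_∞/K_∞⁻` of the cell's
two-variable descent (crux 2, (R3′)), previously a displayed hypothesis.
[cite: GreenbergLNM1716, §1 p. 53] [cite: Greenberg1978, §4 p. 94] [cite: deShalit1987, II.1.9, II.4.17]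
[cite: SerreLocalFields1979, Ch. XIV §7 Thm. 2] [cite: Brink2007, Cor. 1 (p. 2136)] -/
theorem inertia_inf_kerSubgroup_le_kerSubgroup_of_isAnticyclotomic (hK : IsImaginaryQuadratic K)
    (hp2 : p ≠ 2) {κ₁ : ZpExtension K p} (hκ₁ : κ₁.IsAnticyclotomic) (κ₂ : ZpExtension K p)
    {v vbar : HeightOneSpectrum (𝓞 K)} (hpv : ((p : ℕ) : 𝓞 K) ∈ v.asIdeal)
    (hpvbar : ((p : ℕ) : 𝓞 K) ∈ vbar.asIdeal) (hne : vbar ≠ v)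
    {w : HeightOneSpectrum (𝓞 K)} (hpw : ((p : ℕ) : 𝓞 K) ∈ w.asIdeal)
    {𝔓 : Ideal (absIntegers (𝓞 K) K)} (h𝔓 : 𝔓 ∈ w.primesAbove) :
    𝔓.inertia (absoluteGaloisGroup K) ⊓ κ₁.kerSubgroup ≤ κ₂.kerSubgroup := by
  have hp : p.Prime := Fact.out
  intro σ hσ
  obtain ⟨hσI, hσ₁⟩ := Subgroup.mem_inf.mp hσ
  haveI : Algebra.IsQuadraticExtension ℚ K := ⟨hK.1⟩
  haveI : IsGalois ℚ K := inferInstance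
  -- the place `u = (p)` of `ℚ` below `w`, and the complete splitting of `(p)` in `K`
  have hu : (Rat.HeightOneSpectrum.primesEquiv (w.under (𝓞 ℚ)) : ℕ) = p :=
    primesEquiv_eq_of_natCast_mem hp (natCast_mem_under_rat hpw)
  have hwu : w.asIdeal.under (𝓞 ℚ) = (w.under (𝓞 ℚ)).asIdeal :=
    (HeightOneSpectrum.under_asIdeal (𝓞 ℚ) w).symm
  have hsplit : (((w.under (𝓞 ℚ)).asIdeal).primesOver (𝓞 K)).ncard = Module.finrank ℚ K := by
    rw [rat_heightOneSpectrum_eq_of_natCast_mem hp (natCast_mem_under_rat hpw)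
      (natCast_mem_under_rat hpv)]
    exact ncard_primesOver_under_eq_finrank_of_ne hK.1 hpv hpvbar hne
  -- a ramified element for `κ₁`
  obtain ⟨τ, hτI, hτ⟩ := exists_mem_inertia_apply_ne_one_of_isAnticyclotomic hK hp2 κ₁ hκ₁ hpw h𝔓
  -- proportionality on `I_𝔓`
  have hdet := toAdd_mul_comm_of_mem_inertia_of_ncard_primesOver_eq hp2 hu hsplit hwu h𝔓
    κ₁.toContinuousMonoidHom.toMonoidHom κ₂.toContinuousMonoidHom.toMonoidHom
    κ₁.toContinuousMonoidHom.continuous κ₂.toContinuousMonoidHom.continuous hσI hτI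
  change (κ₁ σ).toAdd * (κ₂ τ).toAdd = (κ₂ σ).toAdd * (κ₁ τ).toAdd at hdet
  rw [mem_kerSubgroup] at hσ₁ ⊢
  rw [hσ₁, toAdd_one, zero_mul, eq_comm, mul_eq_zero] at hdet
  rcases hdet with h | h
  · exact Multiplicative.toAdd.injective (by rw [h, toAdd_one])
  · exact absurd (Multiplicative.toAdd.injective (by rw [h, toAdd_one])) hτ

/-- Membership form: **an element of an inertia group above the split odd prime `p` which fixes the
anticyclotomic tower fixes every `ℤ_p`-extension of the imaginary quadratic field `K`** (`κ₁ σ = 0 ⟹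
κ₂ σ = 0` for `σ ∈ I_𝔓`, `𝔓 ∣ p`) — the shape of the displayed hypothesis of the cell's (R3′) file (B).
[cite: GreenbergLNM1716, §1 p. 53] [cite: Greenberg1978, §4 p. 94] [cite: Brink2007, Cor. 1 (p. 2136)] -/
theorem apply_eq_one_of_mem_inertia_of_isAnticyclotomic (hK : IsImaginaryQuadratic K)
    (hp2 : p ≠ 2) {κ₁ : ZpExtension K p} (hκ₁ : κ₁.IsAnticyclotomic) (κ₂ : ZpExtension K p)
    {v vbar : HeightOneSpectrum (𝓞 K)} (hpv : ((p : ℕ) : 𝓞 K) ∈ v.asIdeal)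
    (hpvbar : ((p : ℕ) : 𝓞 K) ∈ vbar.asIdeal) (hne : vbar ≠ v)
    {w : HeightOneSpectrum (𝓞 K)} (hpw : ((p : ℕ) : 𝓞 K) ∈ w.asIdeal)
    {𝔓 : Ideal (absIntegers (𝓞 K) K)} (h𝔓 : 𝔓 ∈ w.primesAbove)
    {σ : absoluteGaloisGroup K} (hσ : σ ∈ 𝔓.inertia (absoluteGaloisGroup K)) (hσ₁ : κ₁ σ = 1) :
    κ₂ σ = 1 :=
  mem_kerSubgroup.mp (inertia_inf_kerSubgroup_le_kerSubgroup_of_isAnticyclotomic hK hp2 hκ₁ κ₂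
    hpv hpvbar hne hpw h𝔓 ⟨hσ, mem_kerSubgroup.mpr hσ₁⟩)

end ClassNumber

end Literature.NumberTheory.EllipticCurves.ZpExtension

end
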